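import Summits.ResolutionOfSingularities.ResolutionOfSingularities.Theorems.EquisingularLiftEquisingularLiftOfSigmaMaxCP2008
import HarnessLib

/-!
# PROPOSAL (not registered): skeleton v11 for crux `EquisingularLift` (stmt-ResolutionOfSingularities-15660), line `Sketch`

[OURS · leafhand-res-equisingularlift-1 g1, 2026-08-31] A reshape PROPOSAL for the planner / next lead — NOT registered by
this hand (registration is the lead's act). Same composition idea as v10c (`f3e6993bf39ec5c9`: linear-centre lift over
regular blow-up models, dimension split 3 / 4 / ≥ 5), with the two printed-theorem stubs replaced by the SHARPEST inputs the
tree now supports (helper files p798090, p798185, p798346):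

* `stub_cjsSigmaMaxElimination : CossartJannsenSaito2020_sigmaMaxElimination.{0}` — VERBATIM the registered stub of crux
  `SigmaMaxModifications` (lines `Sketch` / `pointed_reduction` / `hs_curve_locus`); CJS Thm. 6.28 + 3.10 (1);
* `stub_cp2008Threefolds : CP2008.ResolutionQuasiProjectiveThreefolds.{0}` — Cossart–Piltant 2008 Thm. 2.1 / 2009 verbatim
  (weaker than CP 2019 Thm. 1.1; its printed-leaves split is `CP2008.resolutionQuasiProjectiveThreefolds_of_printedLeaves_residuals₀`);
* `stub_blowupModel_ge_five` — unchanged (the open residual; = resolution in dimension `≥ 4` over `k̄`).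

`EquisingularLift_of` concludes the crux BY NAME from the three stubs via
`EquisingularLift_of_sigmaMaxElimination_CP2008_of_blowupModels_ge_five` (tree, p798346). Sorries only in `stub_*`.
-/

set_option linter.dupNamespace false

noncomputable section

open Literature.AlgebraicGeometry.Resolution Literature.AlgebraicGeometry.CossartPiltant200819

namespace Summit.ResolutionOfSingularities.ResolutionOfSingularities.Cruxes.EquisingularLift.StrataSplit

/-- STUB (shared verbatim with crux `SigmaMaxModifications`): `Σ^max`-eliminations exist in dimension `≤ 2`
(CJS Thm. 6.28 with Thm. 3.10 (1) and Def. 6.14). [cite: CossartJannsenSaito2020, Thm. 6.28] -/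
theorem stub_cjsSigmaMaxElimination : CossartJannsenSaito2020_sigmaMaxElimination.{0} := by
  sorry

/-- STUB: Cossart–Piltant 2008 Thm. 2.1 / 2009 "Theorem", verbatim rendering. [cite: CossartPiltant2008, Thm 2.1 (HAL p. 3)] -/
theorem stub_cp2008Threefolds : CP2008.ResolutionQuasiProjectiveThreefolds.{0} := by
  sorry

/-- STUB (open residual, unchanged from v10c): regular blow-up models of integral hypersurfaces of `ℙⁿ_k̄`, `n ≥ 5`. [folklore] -/
theorem stub_blowupModel_ge_five : ∀ p : ℕ, p.Prime → ∀ (k : Type) [Field k] [CharP k p] [IsAlgClosed k] (n : ℕ) (H : AlgebraicGeometry.Scheme.{0}) (ι : H ⟶ (Literature.AlgebraicGeometry.Motives.projectiveSpace n k).left), AlgebraicGeometry.IsClosedImmersion ι → AlgebraicGeometry.IsIntegral H → (∀ y : (Literature.AlgebraicGeometry.Motives.projectiveSpace n k).left, ∃ U : (Literature.AlgebraicGeometry.Motives.projectiveSpace n k).left.affineOpens, y ∈ (U : (Literature.AlgebraicGeometry.Motives.projectiveSpace n k).left.Opens) ∧ (ι.ker.ideal U).IsPrincipal) → 5 ≤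 n → ∃ 𝔞 : H.IdealSheafData, 𝔞 ≠ ⊥ ∧ ∀ (Z : AlgebraicGeometry.Scheme.{0}) (π : Z ⟶ H), Literature.AlgebraicGeometry.Resolution.IsBlowup π 𝔞 → Literature.AlgebraicGeometry.Resolution.Scheme.IsRegular Z := by
  sorry

/-- The crux BY NAME from the three stubs. [folklore] -/
theorem EquisingularLift_of :
    Summit.ResolutionOfSingularities.ResolutionOfSingularities.Theses.EquisingularLift.EquisingularLift :=
  EquisingularLift_of_sigmaMaxElimination_CP2008_of_blowupModels_ge_five
    stub_cjsSigmaMaxElimination stub_cp2008Threefolds stub_blowupModel_ge_five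

end Summit.ResolutionOfSingularities.ResolutionOfSingularities.Cruxes.EquisingularLift.StrataSplit

end
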